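import Summits.QuantumFields.YangMills.Theorems.UnitScaleTiltProp7GaugeFixedFloorSchurDoor
import Summits.QuantumFields.YangMills.Theorems.UnitScaleTiltProp7AdjointIntertwiner
import Summits.QuantumFields.YangMills.Theorems.UnitScaleTiltProp7CoerciveOfGaugeFixedLift
import HarnessLib

/-!
# Route `UnitScaleTilt`, crux «MinimiserStabilityRegPr» (stmt-QuantumFields-19200, stub EX), node N06(d = 3), route (α) — **THE MIXING ROW (X) OF THE γ-ROW'S SCHUR DOOR
# SPLITS INTO A HESSIAN-MIXING ROW (XM) AND A LONGITUDINAL-DEFECT ROW (LD); AT THE FLAT MEMBER (XM) VANISHES AND (T), (G) ARE KERNEL, SO THE FLAT DOOR HAS ONE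
# INPUT, (LD) — the coarse `H⁻¹`-size of the divergence defect `D̄*(Q_kY)` of the average of a transverse field** ([Balaban1984PropagatorsI] (1.90)'s mode-by-mode quantity)

Cell `ym3-torus` (HUMAN RULING D-0037, YM ladder rung R3 — YM₃ on T³ is a RUNG, NOT d = 4, NOT the Clay problem; the YM mass gap is NOT proved).  Fleet lead seat
`ym-ust-19200-p1` (gen 23), positivity-block lane of the EX face; pen (X) «unsigned mixing» of LOCATE-GAMMA-ROW-p1g22 §1∕§3, second file (★★OWNER ym3-torus-plan g32 ROUTING WORD
2026-08-29T19:10:15Z «(X) unsigned mixing → ★p1 g23 (consumes (a))»; (a) = routeR-w3 g11 ✓`Prop7AdjointIntertwiner`, consumed in §5).  THEOREMS ONLY (0 `def`, 0 `sorry`);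
`--supports stmt-QuantumFields-19200 --as helper`; count-neutral.

THE PRINT.  [Balaban1985BackgroundPropagators] Thm 3.11 p. 416; (3.118)–(3.122) pp. 419–420; (3.114)–(3.115) p. 418 *«Q_kDλ = D_kQ′_kλ»*; (3.10) p. 392 `Δ = D*D + Δ′`.
[Balaban1984PropagatorsI] Prop. 1.1 (1.90) p. 33; (1.4) p. 18 (`curl ∘ grad = 0` at the flat background).

WHY THIS FILE.  ✓`Prop7GaugeFixedFloorSchurDoor.gaugeFixedFloor_of_TGX` (this seat, file 1) derives the γ-row on the slice `{R_S D* A = 0}` from (T) a transverse floor, (G) a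
slice-gauge floor and (X) a ONE-SIDED mixing row `−(θ_T E_T + θ_G E_G + m‖Y‖‖Dμ‖) ≤ re⟨Y, MDμ⟩ + re⟨Dμ, MY⟩ + 2a·re⟨Q_kY, Q_kDμ⟩`.  The two summands of (X) have different
mechanisms (LOCATE-GAMMA-ROW §1 (X)): the HESSIAN MIXING `re⟨Y, MDμ⟩ + re⟨Dμ, MY⟩` (zero at the flat member — `Δ^η(1)` kills pure gauges, ✓`Prop7LaplaceAFlatCoercive.DeltaEta_one_DL2_one`;
at a curved member it carries the curvature commutator `curl_{U₀}∘D_{U₀} = [F, ·]`) and the AVERAGING MIXING `2a·re⟨Q_kY, Q_kDμ⟩`, of which only the component of `Q_kY` ALONG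
the coarse gauge directions `range(Q_k∘D_{U₀})` counts (file 1 §6) — for a transverse `Y` this component is the defect «`D̄*∘Q ≠ Q″∘D*`» measured in the coarse `H⁻¹` norm, the
quantity [B4] (1.90) bounds mode by mode.  This file displays the two as separate rows with their own budgets and proves (XM) ∧ (LD) ∧ (GQ) ⟹ (X), hence the five-row door;
then it discharges EVERYTHING BUT (LD) at the flat member `U₀ = 1` by kernel: (XM)(1) with zero budget, (GQ)(1) with `ρ = 1`, and (T)(1), (G)(1) as restrictions of the landed flat
γ-row ✓`Prop7CoerciveOfGaugeFixedLift.gaugeFixedFloor_one_piSlot` (file 1 §5 necessity) — NOT a standalone (G)-flat pen (★★OWNER 19:10:15Z: (G) = Track A N06; here (G)(1) is a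
three-line restriction, cited to lit ✓`b05_form_lower` through its consumer chain).

WHAT IS PROVED (ns `…Theorems.Prop7GaugeFixedFloorDefectDoor`; member `F n K`, `h : n ≤ K`, weights `c₀ cB > 0`, coupling `0 ≤ a`, ANY background unless stated, ANY slot `M`).
* §1 ★ `re_inner_eq_of_orthogonal_range` (if `Q_kY − ℓ ⊥ Q_kDμ` then `re⟨Q_kY, Q_kDμ⟩ = re⟨ℓ, Q_kDμ⟩`).
* §2 ★★★ `mixingRow_of_XM_LD` — (XM) `−(θ′_T E_T + θ′_G E_G + m‖Y‖‖Dμ‖) ≤ re⟨Y, MDμ⟩ + re⟨Dμ, MY⟩` ∧ (LD) `∀ Y, D*Y = 0 → ∃ ℓ, (∀ μ′, ⟪Q_kY − ℓ, Q_kDμ′⟫ = 0) ∧ ‖ℓ‖² ≤ κ·E_T(Y)`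
  ∧ (GQ) `a‖Q_kDμ‖² ≤ ρ·E_G(μ)` on slice `μ` ⟹ file 1's (X) row with `θ_T := θ′_T + aκ∕t`, `θ_G := θ′_G + tρ` (any `t > 0`).
* §3 ★★★ `gaugeFixedFloor_of_T_G_XM_LD` — THE FIVE-ROW DOOR (T) ∧ (G) ∧ (XM) ∧ (LD) ∧ (GQ) ⟹ γ-row with `γ = min((1−θ′_T−aκ∕t)c_T, (1−θ′_G−tρ)c_G) − m∕2` (general `M`);
  ★★ `gaugeFixedFloor_DeltaEta_of_T_G_XM_LD` (slot `Δ^η(U₀)`, symmetric: (XM) reads `−(…) ≤ 2re⟨Y, Δ^ηDμ⟩`).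
* §4 THE FLAT MEMBER `U₀ = 1`: `re_inner_DeltaEta_one_DL2` ∕ `re_inner_DL2_DeltaEta_one` (both Hessian mixing terms vanish), `energyG_one` (`E_G(μ) = a‖Q_kD₁μ‖²`),
  ★★★ `gaugeFixedFloor_one_of_T_G_LD` — AT THE FLAT MEMBER THE γ-ROW ⟸ (T)(1) ∧ (G)(1) ∧ (LD)(1), `γ = min((1−aκ∕t)c_T, (1−t)c_G)`;
  ★ `transverseFloor_one` ∕ ★ `sliceGaugeFloor_one` — (T)(1), (G)(1) ARE KERNEL (`c = 1∕(4·Cst 3 a₀)` at `a = a₀(c₀∕cB)η⁻³`, restrictions of ✓`gaugeFixedFloor_one_piSlot`), and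
  ★★ `sliceGaugeFloor_one_pure` — (G)(1) in its honest shape `γ‖D₁μ‖² ≤ a‖Q_k(1)D₁μ‖²` (the coarse inequality «`M₂Δ̄M₂ ≥ c·M₃`» of LOCATE §1 (G), flat, kernel by restriction).
* §5 CONSUMING (a): `orthogonal_range_iff_DstarL2_adjoint` (`(∀ μ′, ⟪v, Q_kDμ′⟫ = 0) ↔ D*_{U₀}(Q_k†v) = 0` — adjointness), ★ `orthogonal_range_iff_adjoint_intertwiner`
  (↔ `Q₂†(D₂†(Q_k† … )) …`: with routeR-w3's ✓`DstarL2_comp_adjoint_QL2_eq` the (LD) orthogonality clause says «`ℓ` has the same coarse divergence `D₂†` as `Q_kY`, tested on `range Q₂`»).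
EFFECT (numbers, not adjectives): the (X) row is now two named rows with separate budgets; at the flat member FOUR of the door's five rows are kernel ((T)(1), (G)(1) by restriction,
(XM)(1) = 0, (GQ)(1) with ρ = 1), leaving ONE displayed flat input, (LD)(1): `∃ ℓ ⊥-equivalent to Q_kY on range(Q_k∘D₁) with ‖ℓ‖² ≤ κ·E_T(Y)`, window `aκ < t(1 − …)` — the
Fourier content of [B4] (1.90) for transverse fields.  At a curved member (XM) carries `⟨curl Y, [F, μ]⟩` (✓`Prop7PureGaugeCurlCurvature`), whose product-currency size needs a
Poincaré constant for the slice potential `μ` — the located reason the curved γ-row is N06-class (LOCATE-RCORE (γ)(δ)) and not an R3 pen.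
HONEST SCOPE.  Finite-dimensional linear algebra over landed letters and the landed flat γ-row; no estimate of print is proved; (LD), (T), (G) at curved members, the γ-row at curved
members, `hPos₁ hPosπ hPosΔ`, the other print rows, `hThm2S`, EX and the crux are NOT proved; nothing continuum ∕ OS ∕ mass-gap ∕ Clay.

References: T. Bałaban, CMP **99** (1985) 389–434 [Balaban1985BackgroundPropagators] (Thm 3.11 p.416, (3.118)–(3.122) pp.419–420, (3.114)–(3.115) p.418, (3.10) p.392);
CMP **95** (1984) 17–40 [Balaban1984PropagatorsI] (Prop. 1.1 (1.90) p.33, (1.4) p.18); T. Kato, *Perturbation Theory for Linear Operators* (1966) VI §1.6 [Kato1966].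
-/

set_option autoImplicit false

noncomputable section

open scoped InnerProductSpace ComplexConjugate Matrix.Norms.L2Operator

namespace Summit.QuantumFields.YangMills.Theorems.Prop7GaugeFixedFloorDefectDoor

open Literature.MathematicalPhysics.QuantumFieldTheory.Balaban1983to89
open Literature.MathematicalPhysics.QuantumFieldTheory.Balaban1983to89.T3ContinuumYM3Torus
open T3SectALandauChart (eta eta_pos)
open T3PrintedRegularOrbits (sites_eq)
open T3LevelShift (siteShift)
open B9Eq311L2Pairing (WL2)
open B11Eq103H1Complex (SiteL2K BondL2K)
open Summit.QuantumFields.YangMills.Theorems.Prop7SectET3Transport (periodsT3)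
open Summit.QuantumFields.YangMills.Theorems.Prop7SectET3HilbertLetters (W₂ toL2S QL2 DL2 DstarL2 covLapSite)
open Summit.QuantumFields.YangMills.Theorems.Prop7SectET3GaugeProjector (RS)
open Summit.QuantumFields.YangMills.Theorems.Prop7SectET3WilsonHessian (DeltaEta DeltaEta_isSymmetric)
open Summit.QuantumFields.YangMills.Theorems.Prop7SectET3CurvedPropagators (Qk)
open Summit.QuantumFields.YangMills.Theorems.Prop7SectET3OpsT3HilbertRows (inner_DL2_left inner_Qk_left)
open Summit.QuantumFields.YangMills.Theorems.Prop7GaugeFixedFloorSchurDoor (gaugeFixedFloor_of_TGX re_inner_symm_of_isSymmetric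
  transverseFloor_of_gaugeFixedFloor sliceGaugeFloor_of_gaugeFixedFloor)
open Summit.QuantumFields.YangMills.Theorems.Prop7LaplaceAFlatCoercive (DeltaEta_one_DL2_one)
open Summit.QuantumFields.YangMills.Theorems.Prop7CoerciveOfGaugeFixedLift (gaugeFixedFloor_one_piSlot)
open Summit.QuantumFields.YangMills.Theorems.Prop7AdjointIntertwiner (DstarL2_adjoint_QL2_apply)

/-! ## §1 One piece of algebra -/

section Member

variable {F : T3Family} {n K : ℕ} {h : n ≤ K} {c₀ cB a : ℝ} [Fact (0 < c₀)] [Fact (0 < cB)]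

/-- ★ **ONLY THE LONGITUDINAL PART MIXES**: if `Q_kY − ℓ` is orthogonal to the coarse gauge direction `Q_kD_{U₀}μ`, then `re⟪Q_kY, Q_kDμ⟫ = re⟪ℓ, Q_kDμ⟫`.
[cite: Balaban1984PropagatorsI, Prop. 1.1 (1.90) p.33] -/
theorem re_inner_eq_of_orthogonal_range (U₀ : GaugeField (F.P K) 0 (Matrix.specialUnitaryGroup (Fin 2) ℂ)) {Y : BondL2K ℂ 3 (periodsT3 F K) c₀ W₂}
    {ℓ : WL2 ℂ (fun _ : PBond (F.P n) 0 => cB) W₂} (μ : SiteL2K ℂ 3 (periodsT3 F K) c₀ W₂)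
    (hℓ : ⟪Qk F n K h c₀ cB U₀ Y - ℓ, Qk F n K h c₀ cB U₀ (DL2 F n K c₀ U₀ μ)⟫_ℂ = 0) :
    RCLike.re ⟪Qk F n K h c₀ cB U₀ Y, Qk F n K h c₀ cB U₀ (DL2 F n K c₀ U₀ μ)⟫_ℂ = RCLike.re ⟪ℓ, Qk F n K h c₀ cB U₀ (DL2 F n K c₀ U₀ μ)⟫_ℂ := by
  rw [inner_sub_left, sub_eq_zero] at hℓ
  rw [hℓ]

/-! ## §2 (X) from (XM), (LD), (GQ) -/

/-- ★★★ **THE MIXING ROW FROM THE HESSIAN-MIXING ROW, THE LONGITUDINAL-DEFECT ROW AND THE PENALTY SHARE OF `E_G`** (every background, every slot `M`, `0 ≤ a`, any `t > 0`):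
(XM) `−(θ′_T E_T(Y) + θ′_G E_G(μ) + m‖Y‖‖Dμ‖) ≤ re⟨Y, MDμ⟩ + re⟨Dμ, MY⟩`; (LD) every transverse `Y` has an `ℓ` with `Q_kY − ℓ ⊥ range(Q_k∘D_{U₀})` and `‖ℓ‖² ≤ κ·E_T(Y)`;
(GQ) `a‖Q_kDμ‖² ≤ ρ·E_G(μ)` for slice `μ` ⟹ the (X) row of ✓`gaugeFixedFloor_of_TGX` with `θ_T := θ′_T + aκ∕t`, `θ_G := θ′_G + tρ`
(`2a·re⟨Q_kY, Q_kDμ⟩ = 2a·re⟨ℓ, Q_kDμ⟩ ≥ −(t·a‖Q_kDμ‖² + (a∕t)‖ℓ‖²)`). [cite: Balaban1985BackgroundPropagators, (3.118)–(3.122) pp.419–420; Balaban1984PropagatorsI, Prop. 1.1 (1.90) p.33] -/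
theorem mixingRow_of_XM_LD (U₀ : GaugeField (F.P K) 0 (Matrix.specialUnitaryGroup (Fin 2) ℂ))
    (M : BondL2K ℂ 3 (periodsT3 F K) c₀ W₂ →ₗ[ℂ] BondL2K ℂ 3 (periodsT3 F K) c₀ W₂) (ha : 0 ≤ a) {θT θG m κ ρ t : ℝ} (ht : 0 < t)
    (hXM : ∀ (Y : BondL2K ℂ 3 (periodsT3 F K) c₀ W₂) (μ : SiteL2K ℂ 3 (periodsT3 F K) c₀ W₂), DstarL2 F n K c₀ U₀ Y = 0 →
      RS F n K h c₀ cB U₀ (covLapSite F n K c₀ U₀ μ) = 0 →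
        -(θT * (RCLike.re ⟪Y, M Y⟫_ℂ + a * ‖Qk F n K h c₀ cB U₀ Y‖ ^ 2)
            + θG * (RCLike.re ⟪DL2 F n K c₀ U₀ μ, M (DL2 F n K c₀ U₀ μ)⟫_ℂ + a * ‖Qk F n K h c₀ cB U₀ (DL2 F n K c₀ U₀ μ)‖ ^ 2)
            + m * (‖Y‖ * ‖DL2 F n K c₀ U₀ μ‖)) ≤
          RCLike.re ⟪Y, M (DL2 F n K c₀ U₀ μ)⟫_ℂ + RCLike.re ⟪DL2 F n K c₀ U₀ μ, M Y⟫_ℂ)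
    (hLD : ∀ Y : BondL2K ℂ 3 (periodsT3 F K) c₀ W₂, DstarL2 F n K c₀ U₀ Y = 0 →
      ∃ ℓ : WL2 ℂ (fun _ : PBond (F.P n) 0 => cB) W₂,
        (∀ μ' : SiteL2K ℂ 3 (periodsT3 F K) c₀ W₂, ⟪Qk F n K h c₀ cB U₀ Y - ℓ, Qk F n K h c₀ cB U₀ (DL2 F n K c₀ U₀ μ')⟫_ℂ = 0) ∧
        ‖ℓ‖ ^ 2 ≤ κ * (RCLike.re ⟪Y, M Y⟫_ℂ + a * ‖Qk F n K h c₀ cB U₀ Y‖ ^ 2))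
    (hGQ : ∀ μ : SiteL2K ℂ 3 (periodsT3 F K) c₀ W₂, RS F n K h c₀ cB U₀ (covLapSite F n K c₀ U₀ μ) = 0 →
      a * ‖Qk F n K h c₀ cB U₀ (DL2 F n K c₀ U₀ μ)‖ ^ 2
        ≤ ρ * (RCLike.re ⟪DL2 F n K c₀ U₀ μ, M (DL2 F n K c₀ U₀ μ)⟫_ℂ + a * ‖Qk F n K h c₀ cB U₀ (DL2 F n K c₀ U₀ μ)‖ ^ 2)) :
    ∀ (Y : BondL2K ℂ 3 (periodsT3 F K) c₀ W₂) (μ : SiteL2K ℂ 3 (periodsT3 F K) c₀ W₂), DstarL2 F n K c₀ U₀ Y = 0 →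
      RS F n K h c₀ cB U₀ (covLapSite F n K c₀ U₀ μ) = 0 →
        -((θT + a * κ / t) * (RCLike.re ⟪Y, M Y⟫_ℂ + a * ‖Qk F n K h c₀ cB U₀ Y‖ ^ 2)
            + (θG + t * ρ) * (RCLike.re ⟪DL2 F n K c₀ U₀ μ, M (DL2 F n K c₀ U₀ μ)⟫_ℂ + a * ‖Qk F n K h c₀ cB U₀ (DL2 F n K c₀ U₀ μ)‖ ^ 2)
            + m * (‖Y‖ * ‖DL2 F n K c₀ U₀ μ‖)) ≤
          RCLike.re ⟪Y, M (DL2 F n K c₀ U₀ μ)⟫_ℂ + RCLike.re ⟪DL2 F n K c₀ U₀ μ, M Y⟫_ℂ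
            + 2 * a * RCLike.re ⟪Qk F n K h c₀ cB U₀ Y, Qk F n K h c₀ cB U₀ (DL2 F n K c₀ U₀ μ)⟫_ℂ := by
  intro Y μ hY hμ
  obtain ⟨ℓ, hℓ, hℓn⟩ := hLD Y hY
  have h1 := hXM Y μ hY hμ
  have h2 := hGQ μ hμ
  -- the averaging term: only `ℓ` mixes, then Cauchy–Schwarz with parameter `t`
  set g : ℝ := ‖Qk F n K h c₀ cB U₀ (DL2 F n K c₀ U₀ μ)‖ with hg
  have hre : RCLike.re ⟪Qk F n K h c₀ cB U₀ Y, Qk F n K h c₀ cB U₀ (DL2 F n K c₀ U₀ μ)⟫_ℂ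
      = RCLike.re ⟪ℓ, Qk F n K h c₀ cB U₀ (DL2 F n K c₀ U₀ μ)⟫_ℂ := re_inner_eq_of_orthogonal_range U₀ μ (hℓ μ)
  have hcs : -(‖ℓ‖ * g) ≤ RCLike.re ⟪ℓ, Qk F n K h c₀ cB U₀ (DL2 F n K c₀ U₀ μ)⟫_ℂ := by
    have := (RCLike.abs_re_le_norm ⟪ℓ, Qk F n K h c₀ cB U₀ (DL2 F n K c₀ U₀ μ)⟫_ℂ).trans (norm_inner_le_norm _ _)
    rw [hg]
    exact neg_le_of_abs_le this
  have hyoung : 2 * (‖ℓ‖ * g) ≤ t * g ^ 2 + ‖ℓ‖ ^ 2 / t := by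
    -- `2xy ≤ t x² + y²/t`: `(t g − ‖ℓ‖)² / t ≥ 0`
    have h0 : 0 ≤ (t * g - ‖ℓ‖) ^ 2 / t := div_nonneg (sq_nonneg _) ht.le
    have e : (t * g - ‖ℓ‖) ^ 2 / t = t * g ^ 2 + ‖ℓ‖ ^ 2 / t - 2 * (‖ℓ‖ * g) := by
      field_simp
      ring
    linarith [h0, e]
  -- budgets
  set ET : ℝ := RCLike.re ⟪Y, M Y⟫_ℂ + a * ‖Qk F n K h c₀ cB U₀ Y‖ ^ 2 with hET
  set EG : ℝ := RCLike.re ⟪DL2 F n K c₀ U₀ μ, M (DL2 F n K c₀ U₀ μ)⟫_ℂ + a * ‖Qk F n K h c₀ cB U₀ (DL2 F n K c₀ U₀ μ)‖ ^ 2 with hEG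
  have h3 : a * (‖ℓ‖ ^ 2 / t) ≤ a * κ / t * ET := by
    have := div_le_div_of_nonneg_right hℓn ht.le
    have e : a * κ / t * ET = a * (κ * ET / t) := by ring
    rw [e]
    exact mul_le_mul_of_nonneg_left this ha
  have h4 : a * (t * g ^ 2) ≤ t * ρ * EG := by
    have := mul_le_mul_of_nonneg_left h2 ht.le
    have e1 : a * (t * g ^ 2) = t * (a * g ^ 2) := by ring
    have e2 : t * ρ * EG = t * (ρ * EG) := by ring
    rw [e1, e2]
    exact this
  have h5 : -(t * ρ * EG + a * κ / t * ET) ≤ 2 * a * RCLike.re ⟪Qk F n K h c₀ cB U₀ Y, Qk F n K h c₀ cB U₀ (DL2 F n K c₀ U₀ μ)⟫_ℂ := by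
    rw [hre]
    have h6 : 2 * a * -(‖ℓ‖ * g) ≤ 2 * a * RCLike.re ⟪ℓ, Qk F n K h c₀ cB U₀ (DL2 F n K c₀ U₀ μ)⟫_ℂ :=
      mul_le_mul_of_nonneg_left hcs (by positivity)
    have h7 : a * (2 * (‖ℓ‖ * g)) ≤ a * (t * g ^ 2 + ‖ℓ‖ ^ 2 / t) := mul_le_mul_of_nonneg_left hyoung ha
    nlinarith [h6, h7, h3, h4]
  nlinarith [h1, h5]

/-! ## §3 The five-row door -/

/-- ★★★ **THE FIVE-ROW DOOR** (every background `U₀`, every slot `M`, `0 ≤ a`, `t > 0`, `0 ≤ m`, windows `θ′_T + aκ∕t ≤ 1`, `θ′_G + tρ ≤ 1`):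
(T) ∧ (G) ∧ (XM) ∧ (LD) ∧ (GQ) ⟹ `(min((1−θ′_T−aκ∕t)c_T, (1−θ′_G−tρ)c_G) − m∕2)‖A‖² ≤ re⟨A, MA⟩ + a‖Q_kA‖²` on `{R_S D* A = 0}` (§2 into ✓`gaugeFixedFloor_of_TGX`).
[cite: Balaban1985BackgroundPropagators, Thm 3.11 p.416, (3.118)–(3.122) pp.419–420; Balaban1984PropagatorsI, Prop. 1.1 (1.90) p.33] -/
theorem gaugeFixedFloor_of_T_G_XM_LD (U₀ : GaugeField (F.P K) 0 (Matrix.specialUnitaryGroup (Fin 2) ℂ))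
    (M : BondL2K ℂ 3 (periodsT3 F K) c₀ W₂ →ₗ[ℂ] BondL2K ℂ 3 (periodsT3 F K) c₀ W₂) (ha : 0 ≤ a) {cT cG θT θG m κ ρ t : ℝ}
    (ht : 0 < t) (hm : 0 ≤ m) (hwT : θT + a * κ / t ≤ 1) (hwG : θG + t * ρ ≤ 1)
    (hT : ∀ Y : BondL2K ℂ 3 (periodsT3 F K) c₀ W₂, DstarL2 F n K c₀ U₀ Y = 0 →
      cT * ‖Y‖ ^ 2 ≤ RCLike.re ⟪Y, M Y⟫_ℂ + a * ‖Qk F n K h c₀ cB U₀ Y‖ ^ 2)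
    (hG : ∀ μ : SiteL2K ℂ 3 (periodsT3 F K) c₀ W₂, RS F n K h c₀ cB U₀ (covLapSite F n K c₀ U₀ μ) = 0 →
      cG * ‖DL2 F n K c₀ U₀ μ‖ ^ 2 ≤ RCLike.re ⟪DL2 F n K c₀ U₀ μ, M (DL2 F n K c₀ U₀ μ)⟫_ℂ + a * ‖Qk F n K h c₀ cB U₀ (DL2 F n K c₀ U₀ μ)‖ ^ 2)
    (hXM : ∀ (Y : BondL2K ℂ 3 (periodsT3 F K) c₀ W₂) (μ : SiteL2K ℂ 3 (periodsT3 F K) c₀ W₂), DstarL2 F n K c₀ U₀ Y = 0 →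
      RS F n K h c₀ cB U₀ (covLapSite F n K c₀ U₀ μ) = 0 →
        -(θT * (RCLike.re ⟪Y, M Y⟫_ℂ + a * ‖Qk F n K h c₀ cB U₀ Y‖ ^ 2)
            + θG * (RCLike.re ⟪DL2 F n K c₀ U₀ μ, M (DL2 F n K c₀ U₀ μ)⟫_ℂ + a * ‖Qk F n K h c₀ cB U₀ (DL2 F n K c₀ U₀ μ)‖ ^ 2)
            + m * (‖Y‖ * ‖DL2 F n K c₀ U₀ μ‖)) ≤
          RCLike.re ⟪Y, M (DL2 F n K c₀ U₀ μ)⟫_ℂ + RCLike.re ⟪DL2 F n K c₀ U₀ μ, M Y⟫_ℂ)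
    (hLD : ∀ Y : BondL2K ℂ 3 (periodsT3 F K) c₀ W₂, DstarL2 F n K c₀ U₀ Y = 0 →
      ∃ ℓ : WL2 ℂ (fun _ : PBond (F.P n) 0 => cB) W₂,
        (∀ μ' : SiteL2K ℂ 3 (periodsT3 F K) c₀ W₂, ⟪Qk F n K h c₀ cB U₀ Y - ℓ, Qk F n K h c₀ cB U₀ (DL2 F n K c₀ U₀ μ')⟫_ℂ = 0) ∧
        ‖ℓ‖ ^ 2 ≤ κ * (RCLike.re ⟪Y, M Y⟫_ℂ + a * ‖Qk F n K h c₀ cB U₀ Y‖ ^ 2))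
    (hGQ : ∀ μ : SiteL2K ℂ 3 (periodsT3 F K) c₀ W₂, RS F n K h c₀ cB U₀ (covLapSite F n K c₀ U₀ μ) = 0 →
      a * ‖Qk F n K h c₀ cB U₀ (DL2 F n K c₀ U₀ μ)‖ ^ 2
        ≤ ρ * (RCLike.re ⟪DL2 F n K c₀ U₀ μ, M (DL2 F n K c₀ U₀ μ)⟫_ℂ + a * ‖Qk F n K h c₀ cB U₀ (DL2 F n K c₀ U₀ μ)‖ ^ 2)) :
    ∀ A : BondL2K ℂ 3 (periodsT3 F K) c₀ W₂, RS F n K h c₀ cB U₀ (DstarL2 F n K c₀ U₀ A) = 0 →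
      (min ((1 - (θT + a * κ / t)) * cT) ((1 - (θG + t * ρ)) * cG) - m / 2) * ‖A‖ ^ 2
        ≤ RCLike.re ⟪A, M A⟫_ℂ + a * ‖Qk F n K h c₀ cB U₀ A‖ ^ 2 :=
  gaugeFixedFloor_of_TGX U₀ M hwT hwG hm hT hG (mixingRow_of_XM_LD U₀ M ha ht hXM hLD hGQ)

/-- ★★ **THE FIVE-ROW DOOR AT THE SLOT `Δ^η(U₀)`** (symmetric, ✓`DeltaEta_isSymmetric`): (XM) reads `−(θ′_T E_T + θ′_G E_G + m‖Y‖‖Dμ‖) ≤ 2·re⟨Y, Δ^η(U₀)D_{U₀}μ⟩`.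
[cite: Balaban1985BackgroundPropagators, Thm 3.11 p.416, (3.118)–(3.122) pp.419–420, (3.10)–(3.12) p.392] -/
theorem gaugeFixedFloor_DeltaEta_of_T_G_XM_LD (U₀ : GaugeField (F.P K) 0 (Matrix.specialUnitaryGroup (Fin 2) ℂ)) (ha : 0 ≤ a)
    {cT cG θT θG m κ ρ t : ℝ} (ht : 0 < t) (hm : 0 ≤ m) (hwT : θT + a * κ / t ≤ 1) (hwG : θG + t * ρ ≤ 1)
    (hT : ∀ Y : BondL2K ℂ 3 (periodsT3 F K) c₀ W₂, DstarL2 F n K c₀ U₀ Y = 0 →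
      cT * ‖Y‖ ^ 2 ≤ RCLike.re ⟪Y, DeltaEta F n K c₀ U₀ Y⟫_ℂ + a * ‖Qk F n K h c₀ cB U₀ Y‖ ^ 2)
    (hG : ∀ μ : SiteL2K ℂ 3 (periodsT3 F K) c₀ W₂, RS F n K h c₀ cB U₀ (covLapSite F n K c₀ U₀ μ) = 0 →
      cG * ‖DL2 F n K c₀ U₀ μ‖ ^ 2 ≤ RCLike.re ⟪DL2 F n K c₀ U₀ μ, DeltaEta F n K c₀ U₀ (DL2 F n K c₀ U₀ μ)⟫_ℂ
        + a * ‖Qk F n K h c₀ cB U₀ (DL2 F n K c₀ U₀ μ)‖ ^ 2)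
    (hXM : ∀ (Y : BondL2K ℂ 3 (periodsT3 F K) c₀ W₂) (μ : SiteL2K ℂ 3 (periodsT3 F K) c₀ W₂), DstarL2 F n K c₀ U₀ Y = 0 →
      RS F n K h c₀ cB U₀ (covLapSite F n K c₀ U₀ μ) = 0 →
        -(θT * (RCLike.re ⟪Y, DeltaEta F n K c₀ U₀ Y⟫_ℂ + a * ‖Qk F n K h c₀ cB U₀ Y‖ ^ 2)
            + θG * (RCLike.re ⟪DL2 F n K c₀ U₀ μ, DeltaEta F n K c₀ U₀ (DL2 F n K c₀ U₀ μ)⟫_ℂ + a * ‖Qk F n K h c₀ cB U₀ (DL2 F n K c₀ U₀ μ)‖ ^ 2)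
            + m * (‖Y‖ * ‖DL2 F n K c₀ U₀ μ‖)) ≤
          2 * RCLike.re ⟪Y, DeltaEta F n K c₀ U₀ (DL2 F n K c₀ U₀ μ)⟫_ℂ)
    (hLD : ∀ Y : BondL2K ℂ 3 (periodsT3 F K) c₀ W₂, DstarL2 F n K c₀ U₀ Y = 0 →
      ∃ ℓ : WL2 ℂ (fun _ : PBond (F.P n) 0 => cB) W₂,
        (∀ μ' : SiteL2K ℂ 3 (periodsT3 F K) c₀ W₂, ⟪Qk F n K h c₀ cB U₀ Y - ℓ, Qk F n K h c₀ cB U₀ (DL2 F n K c₀ U₀ μ')⟫_ℂ = 0) ∧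
        ‖ℓ‖ ^ 2 ≤ κ * (RCLike.re ⟪Y, DeltaEta F n K c₀ U₀ Y⟫_ℂ + a * ‖Qk F n K h c₀ cB U₀ Y‖ ^ 2))
    (hGQ : ∀ μ : SiteL2K ℂ 3 (periodsT3 F K) c₀ W₂, RS F n K h c₀ cB U₀ (covLapSite F n K c₀ U₀ μ) = 0 →
      a * ‖Qk F n K h c₀ cB U₀ (DL2 F n K c₀ U₀ μ)‖ ^ 2
        ≤ ρ * (RCLike.re ⟪DL2 F n K c₀ U₀ μ, DeltaEta F n K c₀ U₀ (DL2 F n K c₀ U₀ μ)⟫_ℂ + a * ‖Qk F n K h c₀ cB U₀ (DL2 F n K c₀ U₀ μ)‖ ^ 2)) :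
    ∀ A : BondL2K ℂ 3 (periodsT3 F K) c₀ W₂, RS F n K h c₀ cB U₀ (DstarL2 F n K c₀ U₀ A) = 0 →
      (min ((1 - (θT + a * κ / t)) * cT) ((1 - (θG + t * ρ)) * cG) - m / 2) * ‖A‖ ^ 2
        ≤ RCLike.re ⟪A, DeltaEta F n K c₀ U₀ A⟫_ℂ + a * ‖Qk F n K h c₀ cB U₀ A‖ ^ 2 := by
  refine gaugeFixedFloor_of_T_G_XM_LD U₀ (DeltaEta F n K c₀ U₀ : BondL2K ℂ 3 (periodsT3 F K) c₀ W₂ →ₗ[ℂ] BondL2K ℂ 3 (periodsT3 F K) c₀ W₂)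
    ha ht hm hwT hwG hT hG (fun Y μ hY hμ => ?_) hLD hGQ
  have hs := re_inner_symm_of_isSymmetric (DeltaEta_isSymmetric (F := F) (n := n) (K := K) (c₀ := c₀) U₀) Y (DL2 F n K c₀ U₀ μ)
  have h1 := hXM Y μ hY hμ
  simp only [ContinuousLinearMap.coe_coe] at hs ⊢
  rw [hs, ← two_mul]
  exact h1

end Member

/-! ## §4 The flat member `U₀ = 1`: (XM)(1) = 0, (GQ)(1) with `ρ = 1`, (T)(1) and (G)(1) kernel — the flat door has ONE input, (LD)(1) -/

section Flat

variable {F : T3Family} {n K : ℕ} {h : n ≤ K} {c₀ cB a : ℝ} [Fact (0 < c₀)] [Fact (0 < cB)]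

/-- **AT THE FLAT BACKGROUND THE HESSIAN MIXING VANISHES, I**: `re⟪Y, Δ^η(1)(D₁μ)⟫ = 0` (✓`DeltaEta_one_DL2_one`: `curl ∘ grad = 0`, `Δ′(1) = 0`).
[cite: Balaban1984PropagatorsI, (1.4) p.18; Balaban1985BackgroundPropagators, (3.10) p.392] -/
theorem re_inner_DeltaEta_one_DL2 (Y : BondL2K ℂ 3 (periodsT3 F K) c₀ W₂) (μ : SiteL2K ℂ 3 (periodsT3 F K) c₀ W₂) :
    RCLike.re ⟪Y, DeltaEta F n K c₀ 1 (DL2 F n K c₀ 1 μ)⟫_ℂ = 0 := by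
  rw [DeltaEta_one_DL2_one (n := n) μ, inner_zero_right, map_zero]

/-- **AT THE FLAT BACKGROUND THE HESSIAN MIXING VANISHES, II**: `re⟪D₁μ, Δ^η(1)Y⟫ = 0` (symmetry of `Δ^η`). [cite: Balaban1984PropagatorsI, (1.4) p.18; Balaban1985BackgroundPropagators, (3.10)–(3.12) p.392] -/
theorem re_inner_DL2_DeltaEta_one (Y : BondL2K ℂ 3 (periodsT3 F K) c₀ W₂) (μ : SiteL2K ℂ 3 (periodsT3 F K) c₀ W₂) :
    RCLike.re ⟪DL2 F n K c₀ 1 μ, DeltaEta F n K c₀ 1 Y⟫_ℂ = 0 := by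
  have hs := re_inner_symm_of_isSymmetric (DeltaEta_isSymmetric (F := F) (n := n) (K := K) (c₀ := c₀) 1) (DL2 F n K c₀ 1 μ) Y
  simp only [ContinuousLinearMap.coe_coe] at hs
  rw [← hs, re_inner_DeltaEta_one_DL2]

/-- **AT THE FLAT BACKGROUND `E_G(μ) = a‖Q_k(1)D₁μ‖²`** (the Hessian part of the slice-gauge energy vanishes). [cite: Balaban1984PropagatorsI, (1.4) p.18, Prop. 1.1 (1.90) p.33] -/
theorem energyG_one (μ : SiteL2K ℂ 3 (periodsT3 F K) c₀ W₂) :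
    RCLike.re ⟪DL2 F n K c₀ 1 μ, DeltaEta F n K c₀ 1 (DL2 F n K c₀ 1 μ)⟫_ℂ + a * ‖Qk F n K h c₀ cB 1 (DL2 F n K c₀ 1 μ)‖ ^ 2
      = a * ‖Qk F n K h c₀ cB 1 (DL2 F n K c₀ 1 μ)‖ ^ 2 := by
  rw [re_inner_DeltaEta_one_DL2, zero_add]

/-- ★★★ **THE FLAT DOOR HAS ONE ANALYTIC INPUT BEYOND THE FLOORS: (LD)(1).**  At `U₀ = 1`, `0 ≤ a`, `0 < t ≤ 1`, `aκ∕t ≤ 1`: (T)(1) ∧ (G)(1) ∧ (LD)(1) ⟹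
`min((1−aκ∕t)c_T, (1−t)c_G)·‖A‖² ≤ re⟨A, Δ^η(1)A⟩ + a‖Q_k(1)A‖²` on `{R_S(1) D*₁ A = 0}` — (XM)(1) holds with zero budget (§4), (GQ)(1) with `ρ = 1`.
[cite: Balaban1984PropagatorsI, Prop. 1.1 (1.90) p.33, (1.4) p.18; Balaban1985BackgroundPropagators, Thm 3.11 p.416] -/
theorem gaugeFixedFloor_one_of_T_G_LD (ha : 0 ≤ a) {cT cG κ t : ℝ} (ht : 0 < t) (ht1 : t ≤ 1) (hw : a * κ / t ≤ 1)
    (hT : ∀ Y : BondL2K ℂ 3 (periodsT3 F K) c₀ W₂, DstarL2 F n K c₀ 1 Y = 0 →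
      cT * ‖Y‖ ^ 2 ≤ RCLike.re ⟪Y, DeltaEta F n K c₀ 1 Y⟫_ℂ + a * ‖Qk F n K h c₀ cB 1 Y‖ ^ 2)
    (hG : ∀ μ : SiteL2K ℂ 3 (periodsT3 F K) c₀ W₂, RS F n K h c₀ cB 1 (covLapSite F n K c₀ 1 μ) = 0 →
      cG * ‖DL2 F n K c₀ 1 μ‖ ^ 2 ≤ RCLike.re ⟪DL2 F n K c₀ 1 μ, DeltaEta F n K c₀ 1 (DL2 F n K c₀ 1 μ)⟫_ℂ + a * ‖Qk F n K h c₀ cB 1 (DL2 F n K c₀ 1 μ)‖ ^ 2)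
    (hLD : ∀ Y : BondL2K ℂ 3 (periodsT3 F K) c₀ W₂, DstarL2 F n K c₀ 1 Y = 0 →
      ∃ ℓ : WL2 ℂ (fun _ : PBond (F.P n) 0 => cB) W₂,
        (∀ μ' : SiteL2K ℂ 3 (periodsT3 F K) c₀ W₂, ⟪Qk F n K h c₀ cB 1 Y - ℓ, Qk F n K h c₀ cB 1 (DL2 F n K c₀ 1 μ')⟫_ℂ = 0) ∧
        ‖ℓ‖ ^ 2 ≤ κ * (RCLike.re ⟪Y, DeltaEta F n K c₀ 1 Y⟫_ℂ + a * ‖Qk F n K h c₀ cB 1 Y‖ ^ 2)) :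
    ∀ A : BondL2K ℂ 3 (periodsT3 F K) c₀ W₂, RS F n K h c₀ cB 1 (DstarL2 F n K c₀ 1 A) = 0 →
      min ((1 - a * κ / t) * cT) ((1 - t) * cG) * ‖A‖ ^ 2 ≤ RCLike.re ⟪A, DeltaEta F n K c₀ 1 A⟫_ℂ + a * ‖Qk F n K h c₀ cB 1 A‖ ^ 2 := by
  have hXM : ∀ (Y : BondL2K ℂ 3 (periodsT3 F K) c₀ W₂) (μ : SiteL2K ℂ 3 (periodsT3 F K) c₀ W₂), DstarL2 F n K c₀ 1 Y = 0 →
      RS F n K h c₀ cB 1 (covLapSite F n K c₀ 1 μ) = 0 →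
        -(0 * (RCLike.re ⟪Y, DeltaEta F n K c₀ 1 Y⟫_ℂ + a * ‖Qk F n K h c₀ cB 1 Y‖ ^ 2)
            + 0 * (RCLike.re ⟪DL2 F n K c₀ 1 μ, DeltaEta F n K c₀ 1 (DL2 F n K c₀ 1 μ)⟫_ℂ + a * ‖Qk F n K h c₀ cB 1 (DL2 F n K c₀ 1 μ)‖ ^ 2)
            + 0 * (‖Y‖ * ‖DL2 F n K c₀ 1 μ‖)) ≤
          2 * RCLike.re ⟪Y, DeltaEta F n K c₀ 1 (DL2 F n K c₀ 1 μ)⟫_ℂ := by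
    intro Y μ _ _
    rw [re_inner_DeltaEta_one_DL2 Y μ]
    simp
  have hGQ : ∀ μ : SiteL2K ℂ 3 (periodsT3 F K) c₀ W₂, RS F n K h c₀ cB 1 (covLapSite F n K c₀ 1 μ) = 0 →
      a * ‖Qk F n K h c₀ cB 1 (DL2 F n K c₀ 1 μ)‖ ^ 2
        ≤ 1 * (RCLike.re ⟪DL2 F n K c₀ 1 μ, DeltaEta F n K c₀ 1 (DL2 F n K c₀ 1 μ)⟫_ℂ + a * ‖Qk F n K h c₀ cB 1 (DL2 F n K c₀ 1 μ)‖ ^ 2) := by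
    intro μ _
    rw [energyG_one, one_mul]
  have hwT : (0 : ℝ) + a * κ / t ≤ 1 := by rw [zero_add]; exact hw
  have hwG : (0 : ℝ) + t * 1 ≤ 1 := by rw [zero_add, mul_one]; exact ht1
  have key := gaugeFixedFloor_DeltaEta_of_T_G_XM_LD (h := h) (cB := cB) 1 ha ht le_rfl hwT hwG hT hG hXM hLD hGQ
  intro A hA
  have h1 := key A hA
  have e : min ((1 - (0 + a * κ / t)) * cT) ((1 - (0 + t * 1)) * cG) - 0 / 2 = min ((1 - a * κ / t) * cT) ((1 - t) * cG) := by
    rw [zero_add, zero_add, mul_one, zero_div, sub_zero]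
  rw [e] at h1
  exact h1

/-- ★ **(T)(1) IS KERNEL**: at the flat member, at print's coupling `a = a₀·(c₀∕cB)·η⁻³`, every transverse `Y` has `(1∕(4·Cst 3 a₀))‖Y‖² ≤ re⟨Y, Δ^η(1)Y⟩ + a‖Q_k(1)Y‖²` —
the restriction of the landed flat γ-row ✓`gaugeFixedFloor_one_piSlot` ([B4] (1.90) via lit ✓`b05_form_lower`) to `ker D*₁ ⊆ {R_S D* A = 0}`.
[cite: Balaban1984PropagatorsI, Prop. 1.1 (1.90) p.33; Balaban1985BackgroundPropagators, (3.118) p.419] -/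
theorem transverseFloor_one {a₀ : ℝ} (ha₀ : 0 < a₀) :
    ∀ Y : BondL2K ℂ 3 (periodsT3 F K) c₀ W₂, DstarL2 F n K c₀ 1 Y = 0 →
      (1 / (4 * B5Prop11Plancherel.Cst 3 a₀)) * ‖Y‖ ^ 2
        ≤ RCLike.re ⟪Y, DeltaEta F n K c₀ 1 Y⟫_ℂ + (a₀ * (c₀ / cB) * ((F.L : ℝ) ^ (K - n)) ^ 3) * ‖Qk F n K h c₀ cB 1 Y‖ ^ 2 :=
  transverseFloor_of_gaugeFixedFloor (a := a₀ * (c₀ / cB) * ((F.L : ℝ) ^ (K - n)) ^ 3) 1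
    (DeltaEta F n K c₀ 1 : BondL2K ℂ 3 (periodsT3 F K) c₀ W₂ →ₗ[ℂ] BondL2K ℂ 3 (periodsT3 F K) c₀ W₂) (gaugeFixedFloor_one_piSlot ha₀)

/-- ★ **(G)(1) IS KERNEL**: at the flat member every slice gauge direction `D₁μ` (`R_S(1)Δ^η₁μ = 0`) has `(1∕(4·Cst 3 a₀))‖D₁μ‖² ≤ re⟨D₁μ, Δ^η(1)D₁μ⟩ + a‖Q_k(1)D₁μ‖²`,
`a = a₀·(c₀∕cB)·η⁻³` — restriction of ✓`gaugeFixedFloor_one_piSlot` (NOT the standalone coarse inequality of LOCATE §3 (c): a corollary by restriction).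
[cite: Balaban1984PropagatorsI, Prop. 1.1 (1.90) p.33; Balaban1985BackgroundPropagators, (3.21)–(3.23) p.394] -/
theorem sliceGaugeFloor_one {a₀ : ℝ} (ha₀ : 0 < a₀) :
    ∀ μ : SiteL2K ℂ 3 (periodsT3 F K) c₀ W₂, RS F n K h c₀ cB 1 (covLapSite F n K c₀ 1 μ) = 0 →
      (1 / (4 * B5Prop11Plancherel.Cst 3 a₀)) * ‖DL2 F n K c₀ 1 μ‖ ^ 2
        ≤ RCLike.re ⟪DL2 F n K c₀ 1 μ, DeltaEta F n K c₀ 1 (DL2 F n K c₀ 1 μ)⟫_ℂ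
          + (a₀ * (c₀ / cB) * ((F.L : ℝ) ^ (K - n)) ^ 3) * ‖Qk F n K h c₀ cB 1 (DL2 F n K c₀ 1 μ)‖ ^ 2 :=
  sliceGaugeFloor_of_gaugeFixedFloor (a := a₀ * (c₀ / cB) * ((F.L : ℝ) ^ (K - n)) ^ 3) 1
    (DeltaEta F n K c₀ 1 : BondL2K ℂ 3 (periodsT3 F K) c₀ W₂ →ₗ[ℂ] BondL2K ℂ 3 (periodsT3 F K) c₀ W₂) (gaugeFixedFloor_one_piSlot ha₀)

/-- ★★ **(G)(1) IN ITS HONEST SHAPE — THE FLAT COARSE INEQUALITY OF LOCATE-GAMMA-ROW §1 (G), KERNEL BY RESTRICTION**: at `U₀ = 1` the Hessian does not see pure gauges, so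
for every slice potential `μ` (`R_S(1)Δ^η₁μ = 0`): `(1∕(4·Cst 3 a₀))·‖D₁μ‖² ≤ a·‖Q_k(1)D₁μ‖²`, `a = a₀(c₀∕cB)η⁻³` — «`M₂Δ̄M₂ ≥ c·M₃`» read on the fine lattice.
[cite: Balaban1984PropagatorsI, Prop. 1.1 (1.90) p.33, (1.4) p.18] -/
theorem sliceGaugeFloor_one_pure {a₀ : ℝ} (ha₀ : 0 < a₀) :
    ∀ μ : SiteL2K ℂ 3 (periodsT3 F K) c₀ W₂, RS F n K h c₀ cB 1 (covLapSite F n K c₀ 1 μ) = 0 →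
      (1 / (4 * B5Prop11Plancherel.Cst 3 a₀)) * ‖DL2 F n K c₀ 1 μ‖ ^ 2
        ≤ (a₀ * (c₀ / cB) * ((F.L : ℝ) ^ (K - n)) ^ 3) * ‖Qk F n K h c₀ cB 1 (DL2 F n K c₀ 1 μ)‖ ^ 2 := by
  intro μ hμ
  have h1 := sliceGaugeFloor_one (h := h) (cB := cB) (n := n) ha₀ μ hμ
  rwa [energyG_one] at h1

end Flat

/-! ## §5 Consuming (a): the orthogonality clause of (LD) is a statement about the coarse divergence of `Q_kY − ℓ` -/

section Adjoint

variable {F : T3Family} {n K : ℕ} {h : n ≤ K} {c₀ cB : ℝ} [Fact (0 < c₀)] [Fact (0 < cB)]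

/-- **`v ⊥ range(Q_k∘D_{U₀})` IFF `D*_{U₀}(Q_k†v) = 0`** (adjointness: `⟪v, Q_kDμ⟫ = ⟪D*Q_k†v, μ⟫`). [cite: Balaban1985BackgroundPropagators, (3.8) p.392, (3.16) p.393] -/
theorem orthogonal_range_iff_DstarL2_adjoint (U₀ : GaugeField (F.P K) 0 (Matrix.specialUnitaryGroup (Fin 2) ℂ)) (v : WL2 ℂ (fun _ : PBond (F.P n) 0 => cB) W₂) :
    (∀ μ : SiteL2K ℂ 3 (periodsT3 F K) c₀ W₂, ⟪v, Qk F n K h c₀ cB U₀ (DL2 F n K c₀ U₀ μ)⟫_ℂ = 0) ↔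
      DstarL2 F n K c₀ U₀ (LinearMap.adjoint (Qk F n K h c₀ cB U₀) v) = 0 := by
  have key : ∀ μ : SiteL2K ℂ 3 (periodsT3 F K) c₀ W₂,
      ⟪v, Qk F n K h c₀ cB U₀ (DL2 F n K c₀ U₀ μ)⟫_ℂ = ⟪DstarL2 F n K c₀ U₀ (LinearMap.adjoint (Qk F n K h c₀ cB U₀) v), μ⟫_ℂ := by
    intro μ
    rw [← inner_conj_symm, inner_Qk_left, inner_DL2_left, inner_conj_symm]
  constructor
  · intro hv
    apply ext_inner_right ℂ
    intro μ
    rw [← key μ, hv μ, inner_zero_left]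
  · intro h0 μ
    rw [key μ, h0, inner_zero_left]

/-- ★ **THE (LD) ORTHOGONALITY CLAUSE IN THE LETTERS OF THE ADJOINT INTERTWINER** (routeR-w3 ✓`Prop7AdjointIntertwiner.DstarL2_adjoint_QL2_apply`): for any pair `(Q″, D′)`
with `Q∘D_{U₀} = D′∘Q″` and the `cS`-dressing `E`, `v ⊥ range(Q_k∘D_{U₀})` iff `Q₂†(D₂†(η̄•v)) = 0`, `Q₂ = E∘Q″`, `D₂ = D′∘E⁻¹` — i.e. the coarse divergence `D₂†` of `v`
vanishes when tested against `range Q₂`. [cite: Balaban1985BackgroundPropagators, (3.115) p.418, (3.8) p.392] -/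
theorem orthogonal_range_iff_adjoint_intertwiner (cS : ℝ) [Fact (0 < cS)] (U₀ : GaugeField (F.P K) 0 (Matrix.specialUnitaryGroup (Fin 2) ℂ))
    (Q'' : SiteL2K ℂ 3 (periodsT3 F K) c₀ W₂ →ₗ[ℂ] (Site (F.P K) (K - n) → Matrix (Fin 2) (Fin 2) ℂ))
    (D' : (Site (F.P K) (K - n) → Matrix (Fin 2) (Fin 2) ℂ) →ₗ[ℂ] WL2 ℂ (fun _ : PBond (F.P n) 0 => cB) W₂)
    (hint : ∀ l, QL2 F n K h c₀ cB U₀ (DL2 F n K c₀ U₀ l) = D' (Q'' l)) (v : WL2 ℂ (fun _ : PBond (F.P n) 0 => cB) W₂) :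
    (∀ μ : SiteL2K ℂ 3 (periodsT3 F K) c₀ W₂, ⟪v, Qk F n K h c₀ cB U₀ (DL2 F n K c₀ U₀ μ)⟫_ℂ = 0) ↔
      LinearMap.adjoint ((toL2S F n cS).toLinearMap ∘ₗ
          (LinearEquiv.funCongrLeft ℂ (Matrix (Fin 2) (Fin 2) ℂ) (siteShift (sites_eq F n K h))).toLinearMap ∘ₗ Q'')
        (LinearMap.adjoint (D' ∘ₗ ((LinearEquiv.funCongrLeft ℂ (Matrix (Fin 2) (Fin 2) ℂ) (siteShift (sites_eq F n K h))).symm.toLinearMap ∘ₗ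
          (toL2S F n cS).symm.toLinearMap)) ((starRingEnd ℂ) ((eta F n K : ℝ) : ℂ) • v)) = 0 := by
  rw [orthogonal_range_iff_DstarL2_adjoint, ← DstarL2_adjoint_QL2_apply F h c₀ cB cS U₀ Q'' D' hint]
  have hadj : LinearMap.adjoint (Qk F n K h c₀ cB U₀) v = LinearMap.adjoint (QL2 F n K h c₀ cB U₀) ((starRingEnd ℂ) ((eta F n K : ℝ) : ℂ) • v) := by
    show LinearMap.adjoint ((((eta F n K : ℝ) : ℂ)) • QL2 F n K h c₀ cB U₀) v = _
    rw [map_smulₛₗ LinearMap.adjoint, LinearMap.smul_apply, ← map_smul]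
  rw [hadj]

end Adjoint

end Summit.QuantumFields.YangMills.Theorems.Prop7GaugeFixedFloorDefectDoor

end
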